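import Literature.NumberTheory.GaloisCohomology.Howard2004.TauEigencocycleFrobeniusProofs
import Literature.NumberTheory.GaloisCohomology.Howard2004.UnramifiedLocalizationFrobeniusProofs
import HarnessLib

/-!
# Howard 2004, Lemma 1.6.2 — the CONCLUSION «`c^± ≠ 0 ⟹ loc_λ(c^±) ≠ 0`»: final assembly
# (non-vanishing at the Frobenius ⟹ non-vanishing of the localization, at an inert unramified prime)

Topic `NumberTheory/GaloisCohomology/Howard2004` (first input of Howard's Lemma 1.6.4 = the residual
Galois input of the print leaf G87 `Howard2004.thm161_dvrKolyvaginBound`; cell `pub/bsd-print-x9`,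
seat `bsd-line-x10b-p1-w6` g8; assembles `TauEigencocycleFrobeniusProofs` (seat `x10b-p1-w2` g15:
the `τ`-eigenspace step joined to the Čebotarev step `ChebotarevInertPrimesProofs`) with
`UnramifiedLocalizationFrobeniusProofs` (evaluation at the Frobenius)).  THEOREMS ONLY: no
definition, no named fact, no instance, no notation, no `sorry`.

Printed source.  B. Howard, *The Heegner point Kolyvagin system*, Compositio Math. **140** (2004)
= arXiv:1202.6340, Lemma 1.6.2 (arXiv Lemma 2.6.2, p. 11 L30–34 and L51–58): «There are infinitely
many primes `λ ∈ 𝓛^{(2k−1)}` such that `c^± ≠ 0 ⟹ loc_λ(c^±) ≠ 0`. … By the Cebotarev theorem,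
there are infinitely many primes `ℓ` of `ℚ` whose Frobenius class in `Gal(E/ℚ)` is equal to
`τσ`, and at which the localizations of `c^±` are unramified.  For such an `ℓ`, the image of `c^±`
under `H¹(K,T̄) → H¹(K_ℓ,T̄) → H¹_unr(K_ℓ,T̄) ≅ T̄` … is equal to `c^±(η) ≠ 0`.»

What is here:
* §1 `exists_finite_forall_inertia_le_of_isOpen` — «at which the localizations of `c^±` are
  unramified»: an open subgroup of `Γ_K` contains the inertia groups above all but finitely many
  finite places (Krull topology + `smul_eq_of_mem_inertia_of_isUnramifiedIn` +
  `finite_setOf_not_isUnramifiedIn`);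
* §2 **`ResidualTau.exists_inert_prime_localization_ne_zero`** — LEMMA 1.6.2's conclusion for a
  pair of `τ`-eigencocycles `φ⁺, φ⁻` (hypotheses VERBATIM those of
  `ResidualTau.exists_inert_prime_isArithFrobAt_apply_ne_zero`, plus `Finite T̄`): a prime `ℓ ∉ B`
  inert in `K`, its place `w ∉ S`, `g ∈ Λ` with `g^τ g ∈ Λ` an arithmetic Frobenius at some
  `𝔔 ∣ w`, the cyclotomic clauses, the inertia group `I_𝔔` acting trivially on `T̄` and killing
  `φ^±`, the evaluation criterion `loc_w [ψ] = 0 ↔ ψ(g^τ g) = 0` for EVERY cocycle `ψ` vanishing on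
  `I_𝔔` (so further classes, e.g. `d = φ⁺ + φ⁻` of Lemma 1.6.4 Case i, are served by the same
  prime), and **`loc_w [φ⁺] ≠ 0`, `loc_w [φ⁻] ≠ 0` in `H¹(K_w, T̄)`**;
* §3 `ResidualTau.exists_inert_prime_localization_ne_zero_single` — the one-class twin.

HONEST FRAMING.  Lemma 1.6.2 is a kernel theorem only in this abstract form (hypotheses: H.1
irreducibility clause, `ResidualTau`/`H5a`, `2 ∈ R×`, an open normal `τ`-stable `Λ` acting
trivially — `ConjugationDatum.exists_standard_open_subgroup` — and `φ^±|_Λ ≠ 0`, which H.2 gives via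
`exists_mem_apply_ne_zero_of_resSubgroup_injOn`); not Lemma 1.6.4, not Thm. 1.6.1; no summit
statement is proved; the Birch–Swinnerton-Dyer conjecture is not proved by any of this.

References: [Howard2004HeegnerKolyvagin] Lemma 1.6.2 (arXiv 2.6.2); [McCallumLMS1991] §3 Cor. 3.2
(proof); [GrossLMS1991] §9 Prop. 9.6; [NeukirchANT1999] I §9.
-/

set_option autoImplicit false

noncomputable section

open scoped Classical Pointwise
open Function NumberField IsDedekindDomain Field

universe u

namespace Literature.NumberTheory.GaloisCohomology.Howard2004

open Literature.NumberTheory.GaloisRepresentations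
open Literature.NumberTheory.EllipticCurves

/-! ## §1 Open subgroups contain almost all inertia groups -/

section Inertia

variable {K : Type u} [Field K] [NumberField K]

/-- **An open subgroup of `Γ_K` contains the inertia groups above all but finitely many finite
places** («at which the localizations of `c^±` are unramified»): an open `U` contains `Gal(K̄/F)`
for a finite normal `F/K` (Krull topology), the inertia group of a prime above a place unramified
in `F` fixes `F` (tree `smul_eq_of_mem_inertia_of_isUnramifiedIn`), and only finitely many places
ramify in `F` (`finite_setOf_not_isUnramifiedIn`).
[cite: McCallumLMS1991, §3 Cor. 3.2 (proof: «different from the finitely many primes where the classes ramify»)] -/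
theorem exists_finite_forall_inertia_le_of_isOpen {U : Subgroup (absoluteGaloisGroup K)}
    (hU : IsOpen (U : Set (absoluteGaloisGroup K))) :
    ∃ T : Set (HeightOneSpectrum (𝓞 K)), T.Finite ∧ ∀ w ∉ T, ∀ 𝔓 ∈ w.primesAbove,
      𝔓.inertia (absoluteGaloisGroup K) ≤ U := by
  have hU1 : (U : Set (absoluteGaloisGroup K)) ∈ nhds (1 : absoluteGaloisGroup K) :=
    hU.mem_nhds U.one_mem
  obtain ⟨F, hFfd, hFn, hFU⟩ :=
    (krullTopology_mem_nhds_one_iff_of_normal K (AlgebraicClosure K) _).mp hU1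
  haveI := hFfd
  haveI := hFn
  haveI : NumberField F := NumberField.of_module_finite K F
  refine ⟨{w | ¬ Algebra.IsUnramifiedIn (𝓞 F) w.asIdeal}, finite_setOf_not_isUnramifiedIn K F,
    fun w hw 𝔓 h𝔓 i hi ↦ ?_⟩
  rw [Set.mem_setOf_eq, not_not] at hw
  apply hFU
  rw [SetLike.mem_coe, IntermediateField.mem_fixingSubgroup_iff]
  intro y hy
  exact smul_eq_of_mem_inertia_of_isUnramifiedIn F F.val hw h𝔓 hi ⟨y, hy⟩

end Inertia

/-! ## §2 Lemma 1.6.2, both eigenclasses -/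

-- `K, Nbar : Type`: the universe of `ConjugationDatum` / `DVRSetting` (`Howard2004/SelmerTriples`).
variable {K : Type} [Field K] [NumberField K] {Nbar : Type} [AddCommGroup Nbar]
  [TopologicalSpace Nbar] [DiscreteTopology Nbar]

namespace ResidualTau

variable {R : Type} [CommRing R] [Module R Nbar] {cd : ConjugationDatum K}
  {ρbar : DiscreteGaloisModule K Nbar}

omit [NumberField K] in
/-- The open subgroup `V = ker ρ̄ ∩ ker φ⁺ ∩ ker φ⁻` of `Γ_K` (finite `T̄`): elements acting
trivially on `T̄` at which both cocycles vanish (a subgroup by the cocycle identity).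
[cite: Howard2004HeegnerKolyvagin, Lemma 1.6.2 proof (arXiv p. 11 L51–54)] -/
theorem exists_isOpen_subgroup_forall_apply_eq [Finite Nbar] (ρbar : DiscreteGaloisModule K Nbar)
    (φp φm : contOneCocycles ρbar.toTopRep) :
    ∃ V : Subgroup (absoluteGaloisGroup K), IsOpen (V : Set (absoluteGaloisGroup K)) ∧
      ∀ g, g ∈ V ↔ (∀ x, ρbar g x = x) ∧ φp.1 g = 0 ∧ φm.1 g = 0 := by
  let V : Subgroup (absoluteGaloisGroup K) :=
    { carrier := {u | (∀ x, ρbar u x = x) ∧ φp.1 u = 0 ∧ φm.1 u = 0}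
      mul_mem' := fun {a b} ha hb ↦ ⟨fun x ↦ by rw [map_mul, Module.End.mul_apply, hb.1, ha.1],
        by rw [apply_mul_eq_add_of_apply_eq_self ρbar φp ha.1, ha.2.1, hb.2.1, add_zero],
        by rw [apply_mul_eq_add_of_apply_eq_self ρbar φm ha.1, ha.2.2, hb.2.2, add_zero]⟩
      one_mem' := ⟨fun x ↦ by rw [map_one, Module.End.one_apply], contOneCocycles.apply_one φp,
        contOneCocycles.apply_one φm⟩
      inv_mem' := fun {a} ha ↦ by
        have hinv : ∀ x, ρbar a⁻¹ x = x := fun x ↦ by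
          conv_lhs => rw [← ha.1 x]
          rw [← Module.End.mul_apply, ← map_mul, inv_mul_cancel, map_one, Module.End.one_apply]
        refine ⟨hinv, ?_, ?_⟩
        · have h := apply_mul_eq_add_of_apply_eq_self ρbar φp ha.1 a⁻¹
          rw [mul_inv_cancel, contOneCocycles.apply_one, ha.2.1, zero_add] at h
          exact h.symm
        · have h := apply_mul_eq_add_of_apply_eq_self ρbar φm ha.1 a⁻¹
          rw [mul_inv_cancel, contOneCocycles.apply_one, ha.2.2, zero_add] at h
          exact h.symm }
  refine ⟨V, ?_, fun g => Iff.rfl⟩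
  have h1 : IsOpen {u : absoluteGaloisGroup K | ∀ x, ρbar u x = x} := by
    rw [Set.setOf_forall]
    exact isOpen_iInter_of_finite fun x ↦ ρbar.isOpen_setOf_apply_eq x
  exact h1.inter (((isOpen_discrete {(0 : Nbar)}).preimage φp.1.continuous).inter
    ((isOpen_discrete {(0 : Nbar)}).preimage φm.1.continuous))

/-- **Howard 2004, Lemma 1.6.2 — «`c^± ≠ 0 ⟹ loc_λ(c^±) ≠ 0`», both eigenclasses** (abstract
hypotheses, verbatim those of `exists_inert_prime_isArithFrobAt_apply_ne_zero` plus `Finite T̄`):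
`K` imaginary quadratic with conjugation datum `cd`; `ρ̄` an `R`-linear finite discrete Galois
module with no proper non-zero `Γ_K`-stable `R`-submodule (H.1) and `G_ℚ`-structure `A` with
H.5(a); `2 ∈ R×`; `Λ ≤ Γ_K` open, normal, `τ`-stable, acting trivially on `T̄`; `φ⁺, φ⁻` continuous
cocycles with `φ^±(g^τ) = ±θ(φ^± g)` on `Λ` and `φ^±|_Λ ≠ 0`.  For every finite set `B` of
rational primes and finite set `S` of places there are: a prime `ℓ ∉ B` with `(ℓ)` prime in `𝓞_K`,
its unique place `w ∉ S`, `g ∈ Λ` with `x = g^τ g ∈ Λ` an arithmetic Frobenius at a prime `𝔔 ∣ w`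
of `\bar ℤ_K` and `φ^±(x) ≠ 0`, the cyclotomic clauses («`Frob_ℓ = τσ` on `μ_m`», `m ∣ ℓ + 1` when
`g` fixes `μ_m`), the inertia group `I_𝔔` acting trivially on `T̄` and killing `φ^±` («the
localizations are unramified»), the evaluation criterion `loc_w [ψ] = 0 ↔ ψ(x) = 0` for every
cocycle `ψ` vanishing on `I_𝔔`, and **`loc_w [φ⁺] ≠ 0`, `loc_w [φ⁻] ≠ 0` in `H¹(K_w, T̄)`**.
[cite: Howard2004HeegnerKolyvagin, Lemma 1.6.2 (arXiv:1202.6340 Lemma 2.6.2, p. 11 L30–58)] -/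
theorem exists_inert_prime_localization_ne_zero [Finite Nbar]
    (hC : Automorphic.chebotarev_artinRep) (hK : IsImaginaryQuadratic K)
    (A : ResidualTau (R := R) cd ρbar) (hlin : ρbar.IsScalarLinear R)
    (hirr : ∀ W : Submodule R Nbar,
      (∀ (σ : absoluteGaloisGroup K) (x : Nbar), x ∈ W → ρbar σ x ∈ W) → W = ⊥ ∨ W = ⊤)
    (h5a : H5a A) (htwo : IsUnit (2 : R)) {Λ : Subgroup (absoluteGaloisGroup K)}
    (hΛo : IsOpen (Λ : Set (absoluteGaloisGroup K))) (hΛn : Λ.Normal)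
    (hΛc : ∀ g ∈ Λ, cd.conj g ∈ Λ) (hΛt : ∀ g ∈ Λ, ∀ x : Nbar, ρbar g x = x)
    (φp φm : contOneCocycles ρbar.toTopRep)
    (hφp : ∀ g ∈ Λ, φp.1 (cd.conj g) = A.θ (φp.1 g))
    (hφm : ∀ g ∈ Λ, φm.1 (cd.conj g) = -A.θ (φm.1 g))
    (hnep : ∃ g ∈ Λ, φp.1 g ≠ 0) (hnem : ∃ g ∈ Λ, φm.1 g ≠ 0)
    (B : Finset ℕ) {S : Set (HeightOneSpectrum (𝓞 K))} (hS : S.Finite) :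
    ∃ ℓ : ℕ, ℓ.Prime ∧ ℓ ∉ B ∧ (Ideal.span {(ℓ : 𝓞 K)}).IsPrime ∧
      ∃ w : HeightOneSpectrum (𝓞 K), w ∉ S ∧ (ℓ : 𝓞 K) ∈ w.asIdeal ∧
        (∀ w' : HeightOneSpectrum (𝓞 K), (ℓ : 𝓞 K) ∈ w'.asIdeal → w' = w) ∧
        ∃ g ∈ Λ, cd.conj g * g ∈ Λ ∧
          (∀ (m : ℕ) (ζ : AlgebraicClosure K), ¬ ℓ ∣ m → ζ ^ m = 1 → cd.τ (g • ζ) = ζ ^ ℓ) ∧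
          (∀ m : ℕ, ¬ ℓ ∣ m → (∀ ζ : AlgebraicClosure K, ζ ^ m = 1 → g • ζ = ζ) → m ∣ ℓ + 1) ∧
          φp.1 (cd.conj g * g) ≠ 0 ∧ φm.1 (cd.conj g * g) ≠ 0 ∧
          ∃ 𝔔 ∈ w.primesAbove, IsArithFrobAt (𝓞 K) (cd.conj g * g) 𝔔 ∧
            (∀ i ∈ 𝔔.inertia (absoluteGaloisGroup K),
              (∀ x, ρbar i x = x) ∧ φp.1 i = 0 ∧ φm.1 i = 0) ∧
            (∀ ψ : contOneCocycles ρbar.toTopRep,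
              (∀ i ∈ 𝔔.inertia (absoluteGaloisGroup K), ψ.1 i = 0) →
                (galoisCohomology.localization ρbar (Sum.inr w) 1 (oneCocycleClass ρbar.toTopRep ψ)
                  = 0 ↔ ψ.1 (cd.conj g * g) = 0)) ∧
            galoisCohomology.localization ρbar (Sum.inr w) 1 (oneCocycleClass ρbar.toTopRep φp)
              ≠ 0 ∧
            galoisCohomology.localization ρbar (Sum.inr w) 1 (oneCocycleClass ρbar.toTopRep φm)
              ≠ 0 := by
  -- the exceptional set: places whose inertia leaves `ker ρ̄ ∩ ker φ⁺ ∩ ker φ⁻`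
  obtain ⟨V, hVopen, hV⟩ := exists_isOpen_subgroup_forall_apply_eq ρbar φp φm
  obtain ⟨T, hTfin, hT⟩ := exists_finite_forall_inertia_le_of_isOpen hVopen
  -- the junction theorem, avoiding `S ∪ T`
  obtain ⟨ℓ, hℓ, hℓB, hinert, w, hwST, hℓw, hwuniq, g, hg, hxΛ, ⟨𝔔, h𝔔, hFrob⟩, hxp, hxm, hcyc,
      hdvd⟩ :=
    exists_inert_prime_isArithFrobAt_apply_ne_zero hC hK A hlin hirr h5a htwo hΛo hΛn hΛc hΛt φp φm
      hφp hφm hnep hnem B (hS.union hTfin)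
  have hwS : w ∉ S := fun h => hwST (Or.inl h)
  have hIV : ∀ i ∈ 𝔔.inertia (absoluteGaloisGroup K), (∀ x, ρbar i x = x) ∧ φp.1 i = 0 ∧ φm.1 i = 0 :=
    fun i hi => (hV i).mp (hT w (fun h => hwST (Or.inr h)) 𝔔 h𝔔 hi)
  have hFρ : ∀ x, ρbar (cd.conj g * g) x = x := hΛt _ hxΛ
  have hcrit : ∀ ψ : contOneCocycles ρbar.toTopRep,
      (∀ i ∈ 𝔔.inertia (absoluteGaloisGroup K), ψ.1 i = 0) →
        (galoisCohomology.localization ρbar (Sum.inr w) 1 (oneCocycleClass ρbar.toTopRep ψ) = 0 ↔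
          ψ.1 (cd.conj g * g) = 0) :=
    fun ψ hψ => localization_oneCocycleClass_eq_zero_iff ρbar ψ h𝔔 hFrob hFρ
      (fun i hi => (hIV i hi).1) hψ
  exact ⟨ℓ, hℓ, hℓB, hinert, w, hwS, hℓw, hwuniq, g, hg, hxΛ, hcyc, hdvd, hxp, hxm, 𝔔, h𝔔, hFrob,
    hIV, hcrit, fun h => hxp ((hcrit φp fun i hi => (hIV i hi).2.1).mp h),
    fun h => hxm ((hcrit φm fun i hi => (hIV i hi).2.2).mp h)⟩

/-! ## §3 Lemma 1.6.2, one class -/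

/-- **Howard 2004, Lemma 1.6.2, one class** («the other case being entirely similar»): for ONE
continuous cocycle `φ` with `φ(g^τ) = L(φ g)` on `Λ` for an `R`-linear `L` fixing a non-zero `v`
(`L = θ`, `v = x⁺` for `c ∈ H¹(K,T̄)⁺`; `L = -θ`, `v = x⁻` for `c ∈ H¹(K,T̄)⁻`) and `φ|_Λ ≠ 0`:
the same package — `ℓ ∉ B` inert, `w ∉ S`, `g ∈ Λ`, `x = g^τ g ∈ Λ` a Frobenius at `𝔔 ∣ w` with
`φ(x) ≠ 0`, the cyclotomic clauses, unramified inertia, the evaluation criterion for every cocycle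
vanishing on `I_𝔔`, and **`loc_w [φ] ≠ 0`**.
[cite: Howard2004HeegnerKolyvagin, Lemma 1.6.2 (arXiv:1202.6340 Lemma 2.6.2, p. 11 L30–58)] -/
theorem exists_inert_prime_localization_ne_zero_single [Finite Nbar]
    (hC : Automorphic.chebotarev_artinRep) (hK : IsImaginaryQuadratic K) (cd : ConjugationDatum K)
    (ρbar : DiscreteGaloisModule K Nbar) (hlin : ρbar.IsScalarLinear R)
    (hirr : ∀ W : Submodule R Nbar,
      (∀ (σ : absoluteGaloisGroup K) (x : Nbar), x ∈ W → ρbar σ x ∈ W) → W = ⊥ ∨ W = ⊤)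
    (htwo : IsUnit (2 : R)) (L : Nbar →ₗ[R] Nbar) {v : Nbar} (hv : v ≠ 0) (hLv : L v = v)
    {Λ : Subgroup (absoluteGaloisGroup K)} (hΛo : IsOpen (Λ : Set (absoluteGaloisGroup K)))
    (hΛn : Λ.Normal) (hΛc : ∀ g ∈ Λ, cd.conj g ∈ Λ) (hΛt : ∀ g ∈ Λ, ∀ x : Nbar, ρbar g x = x)
    (φ : contOneCocycles ρbar.toTopRep) (hφ : ∀ g ∈ Λ, φ.1 (cd.conj g) = L (φ.1 g))
    (hne : ∃ g ∈ Λ, φ.1 g ≠ 0) (B : Finset ℕ) {S : Set (HeightOneSpectrum (𝓞 K))}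
    (hS : S.Finite) :
    ∃ ℓ : ℕ, ℓ.Prime ∧ ℓ ∉ B ∧ (Ideal.span {(ℓ : 𝓞 K)}).IsPrime ∧
      ∃ w : HeightOneSpectrum (𝓞 K), w ∉ S ∧ (ℓ : 𝓞 K) ∈ w.asIdeal ∧
        (∀ w' : HeightOneSpectrum (𝓞 K), (ℓ : 𝓞 K) ∈ w'.asIdeal → w' = w) ∧
        ∃ g ∈ Λ, cd.conj g * g ∈ Λ ∧
          (∀ (m : ℕ) (ζ : AlgebraicClosure K), ¬ ℓ ∣ m → ζ ^ m = 1 → cd.τ (g • ζ) = ζ ^ ℓ) ∧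
          (∀ m : ℕ, ¬ ℓ ∣ m → (∀ ζ : AlgebraicClosure K, ζ ^ m = 1 → g • ζ = ζ) → m ∣ ℓ + 1) ∧
          φ.1 (cd.conj g * g) ≠ 0 ∧
          ∃ 𝔔 ∈ w.primesAbove, IsArithFrobAt (𝓞 K) (cd.conj g * g) 𝔔 ∧
            (∀ i ∈ 𝔔.inertia (absoluteGaloisGroup K), (∀ x, ρbar i x = x) ∧ φ.1 i = 0) ∧
            (∀ ψ : contOneCocycles ρbar.toTopRep,
              (∀ i ∈ 𝔔.inertia (absoluteGaloisGroup K), ψ.1 i = 0) →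
                (galoisCohomology.localization ρbar (Sum.inr w) 1 (oneCocycleClass ρbar.toTopRep ψ)
                  = 0 ↔ ψ.1 (cd.conj g * g) = 0)) ∧
            galoisCohomology.localization ρbar (Sum.inr w) 1 (oneCocycleClass ρbar.toTopRep φ)
              ≠ 0 := by
  obtain ⟨V, hVopen, hV⟩ := exists_isOpen_subgroup_forall_apply_eq ρbar φ φ
  obtain ⟨T, hTfin, hT⟩ := exists_finite_forall_inertia_le_of_isOpen hVopen
  obtain ⟨ℓ, hℓ, hℓB, hinert, w, hwST, hℓw, hwuniq, g, hg, hxΛ, ⟨𝔔, h𝔔, hFrob⟩, hx, hcyc, hdvd⟩ :=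
    exists_inert_prime_isArithFrobAt_apply_ne_zero_single hC hK cd ρbar hlin hirr htwo L hv hLv hΛo
      hΛn hΛc hΛt φ hφ hne B (hS.union hTfin)
  have hwS : w ∉ S := fun h => hwST (Or.inl h)
  have hIV : ∀ i ∈ 𝔔.inertia (absoluteGaloisGroup K), (∀ x, ρbar i x = x) ∧ φ.1 i = 0 :=
    fun i hi => ⟨((hV i).mp (hT w (fun h => hwST (Or.inr h)) 𝔔 h𝔔 hi)).1,
      ((hV i).mp (hT w (fun h => hwST (Or.inr h)) 𝔔 h𝔔 hi)).2.1⟩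
  have hFρ : ∀ x, ρbar (cd.conj g * g) x = x := hΛt _ hxΛ
  have hcrit : ∀ ψ : contOneCocycles ρbar.toTopRep,
      (∀ i ∈ 𝔔.inertia (absoluteGaloisGroup K), ψ.1 i = 0) →
        (galoisCohomology.localization ρbar (Sum.inr w) 1 (oneCocycleClass ρbar.toTopRep ψ) = 0 ↔
          ψ.1 (cd.conj g * g) = 0) :=
    fun ψ hψ => localization_oneCocycleClass_eq_zero_iff ρbar ψ h𝔔 hFrob hFρ
      (fun i hi => (hIV i hi).1) hψ
  exact ⟨ℓ, hℓ, hℓB, hinert, w, hwS, hℓw, hwuniq, g, hg, hxΛ, hcyc, hdvd, hx, 𝔔, h𝔔, hFrob, hIV,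
    hcrit, fun h => hx ((hcrit φ fun i hi => (hIV i hi).2).mp h)⟩

end ResidualTau

end Literature.NumberTheory.GaloisCohomology.Howard2004

end
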